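import Mathlib
import HarnessLib
import Summits.Ventures.LatticeQCDFlow.Exactness.SU2Omf2EnergyError

/-!
# `SU(2)` rung — THE ENERGY ERROR OF THE ENGINE'S `n`-STEP OMF2 PROPOSAL `flip ∘ (K(λ)D(½)K(1−2λ)D(½)K(λ))ⁿ` WITH THE CONSISTENT KICKS IS `O(nδ²)` WITH EXPLICIT CONSTANTS, for ANY action

HONEST FRAMING: exact (Metropolis-corrected) sampling algorithms for lattice gauge theory;
figures of merit are autocorrelation/cost numbers at stated couplings and volumes; no
continuum-physics claim.

Venture `LatticeQCDFlow` (cell pub-lqcd), topic `Exactness`; FANOUT row 14 (`eng-flowhmc`, engine `latflow.fthmc`,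
family B, `integrator = "omf2"`).  NEW WORK of the cell over `SU2Omf2EnergyError` (the one-step identity and bound),
`SU2ExpDriftWork`, `SplittingWords` / `SplittingIntegrator` (`omf2Word`, `flip`); nothing is cited as a fact; no number.

* `su2Omf2Step_iterate_snd_le` — momentum growth: after `k` steps `‖p_k‖ ≤ ‖p‖ + kγ₂`, `Σ‖p_k,l‖ ≤ Σ‖p_l‖ + k|ι|γ₂`,
  `γ₂ = (2|λ| + |1−2λ|)D_max/κ`;
* **`abs_su2Omf2N_energy_error_le`** — for every `k ≤ N`:
  `|H(wᵏ(q,p)) − H(q,p)| ≤ k·K|δ|·(‖p‖ + (N+1)γ₂)·((8|1−2λ| + 16|λ| + 8)·(Σ_l‖p_l‖ + (N+1)|ι|γ₂) + 32λ²|ι|D_max/κ)`;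
* **`abs_su2Omf2ProposalN_energy_error_le`** — THE ENERGY ERROR OF THE `n`-STEP OMF2 PROPOSAL
  `flip ∘ (omf2Word g₁ (mulDrift e_δ) g₂)ⁿ` (the Metropolis quantity of the exact OMF2 kernel): the same with `k = N = n`
  — `O(nδ²) = O(τδ)` at fixed trajectory length once `K, D_max = O(δ)`; acceptance `≥ exp(−that)` pointwise.

NOT CLAIMED: that OMF2's leading error constant is SMALLER than leapfrog's (the point of OMF2 — a fourth-order
statement in `δ`, beyond a Lipschitz-gradient analysis); mean acceptance (compose with `SU2MomentumLawMoments` as in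
`SU2LeapfrogMeanAcceptance`); OMF4; floating point; any number.
-/

noncomputable section

namespace Summit.Ventures.LatticeQCDFlow.Exactness

open Set Function MeasureTheory NormedSpace
open Literature.MathematicalPhysics.QuantumFieldTheory
open Literature.MathematicalPhysics.QuantumFieldTheory.Balaban1983to89.B10Eq18SigmaSU2Haar (expPauli)
open scoped Matrix Matrix.Norms.Operator InnerProductSpace

set_option backward.isDefEq.respectTransparency false

variable {ι : Type*} [Fintype ι] [DecidableEq ι]

/-- **Momentum growth along the OMF2 trajectory**: after `k` steps the sup norm of the momentum has grown by at most
`k·(2|λ| + |1−2λ|)·D_max/κ`, and `Σ_l‖p_l‖` by at most `k·|ι|·(2|λ| + |1−2λ|)·D_max/κ`. -/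
theorem su2Omf2Step_iterate_snd_le (S : (ι → Matrix.specialUnitaryGroup (Fin 2) ℂ) → ℝ) (δ κ lam : ℝ) (hκ : 0 < κ)
    {Dmax : ℝ} (hD0 : 0 ≤ Dmax) (hDb : ∀ (W : ι → Matrix.specialUnitaryGroup (Fin 2) ℂ) (l : ι), ‖(fun (W : ι → Matrix.specialUnitaryGroup (Fin 2) ℂ) (l : ι) => WithLp.toLp 2 (fun i : Fin 3 => fderiv ℝ (fun a : ι → EuclideanSpace ℝ (Fin 3) => S (su2ExpDrift δ a * W)) 0 (Pi.single l (EuclideanSpace.single i (1 : ℝ))))) W l‖ ≤ Dmax)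
    (q : ι → Matrix.specialUnitaryGroup (Fin 2) ℂ) (p : ι → EuclideanSpace ℝ (Fin 3)) (k : ℕ) :
    ‖((⇑(omf2Word (fun (W : ι → Matrix.specialUnitaryGroup (Fin 2) ℂ) (l : ι) => -(lam / κ) • (fun (W : ι → Matrix.specialUnitaryGroup (Fin 2) ℂ) (l : ι) => WithLp.toLp 2 (fun i : Fin 3 => fderiv ℝ (fun a : ι → EuclideanSpace ℝ (Fin 3) => S (su2ExpDrift δ a * W)) 0 (Pi.single l (EuclideanSpace.single i (1 : ℝ))))) W l) (mulDrift (su2ExpDrift δ)) (fun (W : ι → Matrix.specialUnitaryGroup (Fin 2) ℂ) (l : ι) => -((1 - 2 * lam) / κ) • (fun (W : ι → Matrix.specialUnitaryGroup (Fin 2) ℂ) (l : ι) => WithLp.toLp 2 (fun i : Fin 3 => fderiv ℝ (fun a : ι → EuclideanSpace ℝ (Fin 3) => S (su2ExpDrift δ a * W)) 0 (Pi.single l (EuclideanSpace.single i (1 : ℝ))))) W l)))^[k] (q, p)).2‖ ≤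
        ‖p‖ + k * ((2 * |lam| + |1 - 2 * lam|) * (Dmax / κ)) ∧
      ∑ l, ‖((⇑(omf2Word (fun (W : ι → Matrix.specialUnitaryGroup (Fin 2) ℂ) (l : ι) => -(lam / κ) • (fun (W : ι → Matrix.specialUnitaryGroup (Fin 2) ℂ) (l : ι) => WithLp.toLp 2 (fun i : Fin 3 => fderiv ℝ (fun a : ι → EuclideanSpace ℝ (Fin 3) => S (su2ExpDrift δ a * W)) 0 (Pi.single l (EuclideanSpace.single i (1 : ℝ))))) W l) (mulDrift (su2ExpDrift δ)) (fun (W : ι → Matrix.specialUnitaryGroup (Fin 2) ℂ) (l : ι) => -((1 - 2 * lam) / κ) • (fun (W : ι → Matrix.specialUnitaryGroup (Fin 2) ℂ) (l : ι) => WithLp.toLp 2 (fun i : Fin 3 => fderiv ℝ (fun a : ι → EuclideanSpace ℝ (Fin 3) => S (su2ExpDrift δ a * W)) 0 (Pi.single l (EuclideanSpace.single i (1 : ℝ))))) W l)))^[k] (q, p)).2 l‖ ≤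
        ∑ l, ‖p l‖ + k * (Fintype.card ι * ((2 * |lam| + |1 - 2 * lam|) * (Dmax / κ))) := by
  have hk₁ := norm_su2FracKick_le S δ κ lam hκ hD0 hDb
  have hk₂ := norm_su2FracKick_le S δ κ (1 - 2 * lam) hκ hD0 hDb
  have hk₁l := norm_su2FracKick_apply_le S δ κ lam hκ hDb
  have hk₂l := norm_su2FracKick_apply_le S δ κ (1 - 2 * lam) hκ hDb
  induction k with
  | zero => simp
  | succ k ih =>
    rw [Function.iterate_succ_apply']
    set z := (⇑(omf2Word (fun (W : ι → Matrix.specialUnitaryGroup (Fin 2) ℂ) (l : ι) => -(lam / κ) • (fun (W : ι → Matrix.specialUnitaryGroup (Fin 2) ℂ) (l : ι) => WithLp.toLp 2 (fun i : Fin 3 => fderiv ℝ (fun a : ι → EuclideanSpace ℝ (Fin 3) => S (su2ExpDrift δ a * W)) 0 (Pi.single l (EuclideanSpace.single i (1 : ℝ))))) W l) (mulDrift (su2ExpDrift δ)) (fun (W : ι → Matrix.specialUnitaryGroup (Fin 2) ℂ) (l : ι) => -((1 - 2 * lam) / κ) • (fun (W : ι → Matrix.specialUnitaryGroup (Fin 2)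 ℂ) (l : ι) => WithLp.toLp 2 (fun i : Fin 3 => fderiv ℝ (fun a : ι → EuclideanSpace ℝ (Fin 3) => S (su2ExpDrift δ a * W)) 0 (Pi.single l (EuclideanSpace.single i (1 : ℝ))))) W l)))^[k] (q, p) with hz
    obtain ⟨ih1, ih2⟩ := ih
    have hstep := su2Omf2Step_apply (fun (W : ι → Matrix.specialUnitaryGroup (Fin 2) ℂ) (l : ι) => -(lam / κ) • (fun (W : ι → Matrix.specialUnitaryGroup (Fin 2) ℂ) (l : ι) => WithLp.toLp 2 (fun i : Fin 3 => fderiv ℝ (fun a : ι → EuclideanSpace ℝ (Fin 3) => S (su2ExpDrift δ a * W)) 0 (Pi.single l (EuclideanSpace.single i (1 : ℝ))))) W l) (fun (W : ι → Matrix.specialUnitaryGroup (Fin 2) ℂ) (l : ι) => -((1 - 2 * lam) / κ) • (fun (W : ι → Matrix.specialUnitaryGroup (Fin 2) ℂ) (l : ι) => WithLp.toLp 2 (fun i : Fin 3 => fderiv ℝ (fun a : ι → EuclideanSpace ℝ (Fin 3) => S (su2ExpDrift δ a * W)) 0 (Pi.single l (EuclideanSpace.single i (1 : ℝ))))) W l)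 δ z.1 z.2
    rw [Prod.mk.eta] at hstep
    rw [hstep]
    dsimp only
    constructor
    · refine ((norm_add_le _ _).trans (add_le_add ((norm_add_le _ _).trans (add_le_add ((norm_add_le _ _).trans
        (add_le_add ih1 (hk₁ _))) (hk₂ _))) (hk₁ _))).trans (le_of_eq ?_)
      push_cast; ring
    · calc _ ≤ ∑ l, (‖z.2 l‖ + |lam| * (Dmax / κ) + |1 - 2 * lam| * (Dmax / κ) + |lam| * (Dmax / κ)) := by
            refine Finset.sum_le_sum fun l _ => ?_
            rw [Pi.add_apply, Pi.add_apply, Pi.add_apply]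
            exact (norm_add_le _ _).trans (add_le_add ((norm_add_le _ _).trans (add_le_add ((norm_add_le _ _).trans
              (add_le_add le_rfl (hk₁l _ l))) (hk₂l _ l))) (hk₁l _ l))
        _ = ∑ l, ‖z.2 l‖ + Fintype.card ι * ((2 * |lam| + |1 - 2 * lam|) * (Dmax / κ)) := by
            simp only [Finset.sum_add_distrib, Finset.sum_const, Finset.card_univ, nsmul_eq_mul]; ring
        _ ≤ _ := by push_cast; nlinarith [ih2]

set_option maxHeartbeats 400000 in -- RN-23 (7)(b): heavy declaration budgeted at source (lake build ≈ 10 % hungrier than the gate)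
/-- **THE ENERGY ERROR OF THE `n`-STEP OMF2 TRAJECTORY**: for every `k ≤ N`, with `γ₂ = (2|λ| + |1−2λ|)·D_max/κ`,
`|H(wᵏ(q,p)) − H(q,p)| ≤ k·K|δ|·(‖p‖ + (N+1)γ₂)·((8|1−2λ| + 16|λ| + 8)·(Σ_l‖p_l‖ + (N+1)|ι|γ₂) + 32λ²|ι|D_max/κ)`. -/
theorem abs_su2Omf2N_energy_error_le (S : (ι → Matrix.specialUnitaryGroup (Fin 2) ℂ) → ℝ) (δ κ lam : ℝ) (hκ : 0 < κ)
    (hd : ∀ W : ι → Matrix.specialUnitaryGroup (Fin 2) ℂ,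
      DifferentiableAt ℝ (fun a : ι → EuclideanSpace ℝ (Fin 3) => S (su2ExpDrift δ a * W)) 0)
    {Dmax K : ℝ} (hD0 : 0 ≤ Dmax) (hK0 : 0 ≤ K)
    (hDb : ∀ (W : ι → Matrix.specialUnitaryGroup (Fin 2) ℂ) (l : ι), ‖(fun (W : ι → Matrix.specialUnitaryGroup (Fin 2) ℂ) (l : ι) => WithLp.toLp 2 (fun i : Fin 3 => fderiv ℝ (fun a : ι → EuclideanSpace ℝ (Fin 3) => S (su2ExpDrift δ a * W)) 0 (Pi.single l (EuclideanSpace.single i (1 : ℝ))))) W l‖ ≤ Dmax)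
    (hDK : ∀ W W' : ι → Matrix.specialUnitaryGroup (Fin 2) ℂ, ‖(fun (W : ι → Matrix.specialUnitaryGroup (Fin 2) ℂ) (l : ι) => WithLp.toLp 2 (fun i : Fin 3 => fderiv ℝ (fun a : ι → EuclideanSpace ℝ (Fin 3) => S (su2ExpDrift δ a * W)) 0 (Pi.single l (EuclideanSpace.single i (1 : ℝ))))) W - (fun (W : ι → Matrix.specialUnitaryGroup (Fin 2) ℂ) (l : ι) => WithLp.toLp 2 (fun i : Fin 3 => fderiv ℝ (fun a : ι → EuclideanSpace ℝ (Fin 3) => S (su2ExpDrift δ a * W)) 0 (Pi.single l (EuclideanSpace.single i (1 : ℝ))))) W'‖ ≤ K * ‖coeConfig W - coeConfig W'‖)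
    (q : ι → Matrix.specialUnitaryGroup (Fin 2) ℂ) (p : ι → EuclideanSpace ℝ (Fin 3)) (N : ℕ) :
    ∀ k ≤ N, |(S ((⇑(omf2Word (fun (W : ι → Matrix.specialUnitaryGroup (Fin 2) ℂ) (l : ι) => -(lam / κ) • (fun (W : ι → Matrix.specialUnitaryGroup (Fin 2) ℂ) (l : ι) => WithLp.toLp 2 (fun i : Fin 3 => fderiv ℝ (fun a : ι → EuclideanSpace ℝ (Fin 3) => S (su2ExpDrift δ a * W)) 0 (Pi.single l (EuclideanSpace.single i (1 : ℝ))))) W l) (mulDrift (su2ExpDrift δ)) (fun (W : ι → Matrix.specialUnitaryGroup (Fin 2) ℂ) (l : ι) => -((1 - 2 * lam) / κ) • (fun (W : ι → Matrix.specialUnitaryGroup (Fin 2) ℂ) (l : ι) => WithLp.toLp 2 (fun i : Fin 3 => fderiv ℝ (fun a : ι → EuclideanSpace ℝ (Fin 3) => S (su2ExpDrift δ a * W)) 0 (Pi.single l (EuclideanSpace.single i (1 : ℝ))))) W l)))^[k] (q, p)).1 +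
        su2Kinetic κ ((⇑(omf2Word (fun (W : ι → Matrix.specialUnitaryGroup (Fin 2) ℂ) (l : ι) => -(lam / κ) • (fun (W : ι → Matrix.specialUnitaryGroup (Fin 2) ℂ) (l : ι) => WithLp.toLp 2 (fun i : Fin 3 => fderiv ℝ (fun a : ι → EuclideanSpace ℝ (Fin 3) => S (su2ExpDrift δ a * W)) 0 (Pi.single l (EuclideanSpace.single i (1 : ℝ))))) W l) (mulDrift (su2ExpDrift δ)) (fun (W : ι → Matrix.specialUnitaryGroup (Fin 2) ℂ) (l : ι) => -((1 - 2 * lam) / κ) • (fun (W : ι → Matrix.specialUnitaryGroup (Fin 2) ℂ) (l : ι) => WithLp.toLp 2 (fun i : Fin 3 => fderiv ℝ (fun a : ι → EuclideanSpace ℝ (Fin 3) => S (su2ExpDrift δ a * W)) 0 (Pi.single l (EuclideanSpace.single i (1 : ℝ))))) W l)))^[k] (q, p)).2) -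
        (S q + su2Kinetic κ p)| ≤
      k * (K * |δ| * (‖p‖ + (N + 1) * ((2 * |lam| + |1 - 2 * lam|) * (Dmax / κ))) *
        ((8 * |1 - 2 * lam| + 16 * |lam| + 8) * (∑ l, ‖p l‖ + (N + 1) * (Fintype.card ι * ((2 * |lam| + |1 - 2 * lam|) * (Dmax / κ)))) +
          32 * lam ^ 2 * (Fintype.card ι * Dmax / κ))) := by
  set γ₂ : ℝ := (2 * |lam| + |1 - 2 * lam|) * (Dmax / κ) with hγ₂
  have hγ₂0 : 0 ≤ γ₂ := by rw [hγ₂]; positivity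
  have hγle : (|lam| + |1 - 2 * lam|) * (Dmax / κ) ≤ γ₂ := by
    rw [hγ₂]; nlinarith [abs_nonneg lam, div_nonneg hD0 hκ.le]
  set B := K * |δ| * (‖p‖ + (N + 1) * γ₂) *
    ((8 * |1 - 2 * lam| + 16 * |lam| + 8) * (∑ l, ‖p l‖ + (N + 1) * (Fintype.card ι * γ₂)) + 32 * lam ^ 2 * (Fintype.card ι * Dmax / κ)) with hB
  intro k
  induction k with
  | zero => intro _; simp
  | succ k ih =>
    intro hk
    have hk' : k ≤ N := Nat.le_of_succ_le hk
    have hkN : (k : ℝ) + 1 ≤ N := by exact_mod_cast hk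
    specialize ih hk'
    rw [Function.iterate_succ_apply']
    set z := (⇑(omf2Word (fun (W : ι → Matrix.specialUnitaryGroup (Fin 2) ℂ) (l : ι) => -(lam / κ) • (fun (W : ι → Matrix.specialUnitaryGroup (Fin 2) ℂ) (l : ι) => WithLp.toLp 2 (fun i : Fin 3 => fderiv ℝ (fun a : ι → EuclideanSpace ℝ (Fin 3) => S (su2ExpDrift δ a * W)) 0 (Pi.single l (EuclideanSpace.single i (1 : ℝ))))) W l) (mulDrift (su2ExpDrift δ)) (fun (W : ι → Matrix.specialUnitaryGroup (Fin 2) ℂ) (l : ι) => -((1 - 2 * lam) / κ) • (fun (W : ι → Matrix.specialUnitaryGroup (Fin 2) ℂ) (l : ι) => WithLp.toLp 2 (fun i : Fin 3 => fderiv ℝ (fun a : ι → EuclideanSpace ℝ (Fin 3) => S (su2ExpDrift δ a * W)) 0 (Pi.single l (EuclideanSpace.single i (1 : ℝ))))) W l)))^[k] (q, p) with hz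
    obtain ⟨hz1, hz2⟩ := su2Omf2Step_iterate_snd_le S δ κ lam hκ hD0 hDb q p k
    rw [← hz, ← hγ₂] at hz1 hz2
    have hstep := abs_su2Omf2_energy_error_le S δ κ lam hκ hd hD0 hK0 hDb hDK z.1 z.2
    have happ := su2Omf2Step_apply (fun (W : ι → Matrix.specialUnitaryGroup (Fin 2) ℂ) (l : ι) => -(lam / κ) • (fun (W : ι → Matrix.specialUnitaryGroup (Fin 2) ℂ) (l : ι) => WithLp.toLp 2 (fun i : Fin 3 => fderiv ℝ (fun a : ι → EuclideanSpace ℝ (Fin 3) => S (su2ExpDrift δ a * W)) 0 (Pi.single l (EuclideanSpace.single i (1 : ℝ))))) W l) (fun (W : ι → Matrix.specialUnitaryGroup (Fin 2) ℂ) (l : ι) => -((1 - 2 * lam) / κ) • (fun (W : ι → Matrix.specialUnitaryGroup (Fin 2) ℂ) (l : ι) => WithLp.toLp 2 (fun i : Fin 3 => fderiv ℝ (fun a : ι → EuclideanSpace ℝ (Fin 3) => S (su2ExpDrift δ a * W)) 0 (Pi.single l (EuclideanSpace.single i (1 : ℝ))))) W l) δ z.1 z.2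
    rw [Prod.mk.eta] at happ
    rw [happ]
    simp only
    -- the one-step bound from z is at most B
    have hc : (0 : ℝ) ≤ Fintype.card ι := Nat.cast_nonneg _
    have hkg : (k : ℝ) * γ₂ + γ₂ ≤ (N + 1) * γ₂ := by
      nlinarith [mul_nonneg (sub_nonneg.2 hkN) hγ₂0]
    have hkg2 : (k : ℝ) * (Fintype.card ι * γ₂) + Fintype.card ι * γ₂ ≤ (N + 1) * (Fintype.card ι * γ₂) := by
      nlinarith [mul_nonneg (sub_nonneg.2 hkN) (mul_nonneg hc hγ₂0)]
    have hcg : Fintype.card ι * ((|lam| + |1 - 2 * lam|) * (Dmax / κ)) ≤ Fintype.card ι * γ₂ :=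
      mul_le_mul_of_nonneg_left hγle hc
    have hn1 : ‖z.2‖ + (|lam| + |1 - 2 * lam|) * (Dmax / κ) ≤ ‖p‖ + (N + 1) * γ₂ := by
      linarith [hz1, hγle, hkg]
    have hs1 : ∑ l, ‖z.2 l‖ + Fintype.card ι * ((|lam| + |1 - 2 * lam|) * (Dmax / κ)) ≤
        ∑ l, ‖p l‖ + (N + 1) * (Fintype.card ι * γ₂) := by
      linarith [hz2, hcg, hkg2]
    have hpos1 : 0 ≤ ‖z.2‖ + (|lam| + |1 - 2 * lam|) * (Dmax / κ) := by positivity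
    have hpos2 : 0 ≤ (8 * |1 - 2 * lam| + 16 * |lam| + 8) * (∑ l, ‖z.2 l‖ + Fintype.card ι * ((|lam| + |1 - 2 * lam|) * (Dmax / κ))) +
        32 * lam ^ 2 * (Fintype.card ι * Dmax / κ) := by positivity
    have hstep' : K * |δ| * (‖z.2‖ + (|lam| + |1 - 2 * lam|) * (Dmax / κ)) *
        ((8 * |1 - 2 * lam| + 16 * |lam| + 8) * (∑ l, ‖z.2 l‖ + Fintype.card ι * ((|lam| + |1 - 2 * lam|) * (Dmax / κ))) +
          32 * lam ^ 2 * (Fintype.card ι * Dmax / κ)) ≤ B := by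
      rw [hB]
      have hc8 : (0 : ℝ) ≤ 8 * |1 - 2 * lam| + 16 * |lam| + 8 := by positivity
      gcongr
    -- telescope
    have htri := abs_sub_le
      (S (su2ExpDrift δ ((z.2 + (fun (W : ι → Matrix.specialUnitaryGroup (Fin 2) ℂ) (l : ι) => -(lam / κ) • (fun (W : ι → Matrix.specialUnitaryGroup (Fin 2) ℂ) (l : ι) => WithLp.toLp 2 (fun i : Fin 3 => fderiv ℝ (fun a : ι → EuclideanSpace ℝ (Fin 3) => S (su2ExpDrift δ a * W)) 0 (Pi.single l (EuclideanSpace.single i (1 : ℝ))))) W l) z.1) + (fun (W : ι → Matrix.specialUnitaryGroup (Fin 2) ℂ) (l : ι) => -((1 - 2 * lam) / κ) • (fun (W : ι → Matrix.specialUnitaryGroup (Fin 2) ℂ) (l : ι) => WithLp.toLp 2 (fun i : Fin 3 => fderiv ℝ (fun a : ι → EuclideanSpace ℝ (Fin 3) => S (su2ExpDrift δ a * W)) 0 (Pi.single l (EuclideanSpace.single i (1 : ℝ))))) W l) (su2ExpDrift δ (z.2 + (fun (W : ι → Matrix.specialUnitaryGroup (Fin 2) ℂ) (l : ι) => -(lam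 / κ) • (fun (W : ι → Matrix.specialUnitaryGroup (Fin 2) ℂ) (l : ι) => WithLp.toLp 2 (fun i : Fin 3 => fderiv ℝ (fun a : ι → EuclideanSpace ℝ (Fin 3) => S (su2ExpDrift δ a * W)) 0 (Pi.single l (EuclideanSpace.single i (1 : ℝ))))) W l) z.1) * z.1)) *
            (su2ExpDrift δ (z.2 + (fun (W : ι → Matrix.specialUnitaryGroup (Fin 2) ℂ) (l : ι) => -(lam / κ) • (fun (W : ι → Matrix.specialUnitaryGroup (Fin 2) ℂ) (l : ι) => WithLp.toLp 2 (fun i : Fin 3 => fderiv ℝ (fun a : ι → EuclideanSpace ℝ (Fin 3) => S (su2ExpDrift δ a * W)) 0 (Pi.single l (EuclideanSpace.single i (1 : ℝ))))) W l) z.1) * z.1)) +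
        su2Kinetic κ (((z.2 + (fun (W : ι → Matrix.specialUnitaryGroup (Fin 2) ℂ) (l : ι) => -(lam / κ) • (fun (W : ι → Matrix.specialUnitaryGroup (Fin 2) ℂ) (l : ι) => WithLp.toLp 2 (fun i : Fin 3 => fderiv ℝ (fun a : ι → EuclideanSpace ℝ (Fin 3) => S (su2ExpDrift δ a * W)) 0 (Pi.single l (EuclideanSpace.single i (1 : ℝ))))) W l) z.1) + (fun (W : ι → Matrix.specialUnitaryGroup (Fin 2) ℂ) (l : ι) => -((1 - 2 * lam) / κ) • (fun (W : ι → Matrix.specialUnitaryGroup (Fin 2) ℂ) (l : ι) => WithLp.toLp 2 (fun i : Fin 3 => fderiv ℝ (fun a : ι → EuclideanSpace ℝ (Fin 3) => S (su2ExpDrift δ a * W)) 0 (Pi.single l (EuclideanSpace.single i (1 : ℝ))))) W l) (su2ExpDrift δ (z.2 + (fun (W : ι → Matrix.specialUnitaryGroup (Fin 2) ℂ) (l : ι) => -(lam / κ) • (fun (W : ι → Matrix.specialUnitaryGroup (Fin 2) ℂ) (l : ι) => WithLp.toLp 2 (fun i : Fin 3 => fderiv ℝ (fun a : ι → EuclideanSpace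 ℝ (Fin 3) => S (su2ExpDrift δ a * W)) 0 (Pi.single l (EuclideanSpace.single i (1 : ℝ))))) W l) z.1) * z.1)) +
          (fun (W : ι → Matrix.specialUnitaryGroup (Fin 2) ℂ) (l : ι) => -(lam / κ) • (fun (W : ι → Matrix.specialUnitaryGroup (Fin 2) ℂ) (l : ι) => WithLp.toLp 2 (fun i : Fin 3 => fderiv ℝ (fun a : ι → EuclideanSpace ℝ (Fin 3) => S (su2ExpDrift δ a * W)) 0 (Pi.single l (EuclideanSpace.single i (1 : ℝ))))) W l) (su2ExpDrift δ ((z.2 + (fun (W : ι → Matrix.specialUnitaryGroup (Fin 2) ℂ) (l : ι) => -(lam / κ) • (fun (W : ι → Matrix.specialUnitaryGroup (Fin 2) ℂ) (l : ι) => WithLp.toLp 2 (fun i : Fin 3 => fderiv ℝ (fun a : ι → EuclideanSpace ℝ (Fin 3) => S (su2ExpDrift δ a * W)) 0 (Pi.single l (EuclideanSpace.single i (1 : ℝ))))) W l) z.1) + (fun (W : ι → Matrix.specialUnitaryGroup (Fin 2) ℂ) (l : ι) => -((1 - 2 * lam) / κ) • (fun (W : ι → Matrix.specialUnitaryGroup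 (Fin 2) ℂ) (l : ι) => WithLp.toLp 2 (fun i : Fin 3 => fderiv ℝ (fun a : ι → EuclideanSpace ℝ (Fin 3) => S (su2ExpDrift δ a * W)) 0 (Pi.single l (EuclideanSpace.single i (1 : ℝ))))) W l) (su2ExpDrift δ (z.2 + (fun (W : ι → Matrix.specialUnitaryGroup (Fin 2) ℂ) (l : ι) => -(lam / κ) • (fun (W : ι → Matrix.specialUnitaryGroup (Fin 2) ℂ) (l : ι) => WithLp.toLp 2 (fun i : Fin 3 => fderiv ℝ (fun a : ι → EuclideanSpace ℝ (Fin 3) => S (su2ExpDrift δ a * W)) 0 (Pi.single l (EuclideanSpace.single i (1 : ℝ))))) W l) z.1) * z.1)) *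
            (su2ExpDrift δ (z.2 + (fun (W : ι → Matrix.specialUnitaryGroup (Fin 2) ℂ) (l : ι) => -(lam / κ) • (fun (W : ι → Matrix.specialUnitaryGroup (Fin 2) ℂ) (l : ι) => WithLp.toLp 2 (fun i : Fin 3 => fderiv ℝ (fun a : ι → EuclideanSpace ℝ (Fin 3) => S (su2ExpDrift δ a * W)) 0 (Pi.single l (EuclideanSpace.single i (1 : ℝ))))) W l) z.1) * z.1))))
      (S z.1 + su2Kinetic κ z.2) (S q + su2Kinetic κ p)
    have hfin : (B : ℝ) + k * B = ((k + 1 : ℕ) : ℝ) * B := by push_cast; ring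
    refine htri.trans ?_
    rw [← hfin]
    exact add_le_add (hstep.trans hstep') ih

set_option maxHeartbeats 400000 in -- RN-23 (7)(b): heavy declaration budgeted at source (lake build ≈ 10 % hungrier than the gate)
/-- **THE ENERGY ERROR OF THE `n`-STEP OMF2 PROPOSAL** `flip ∘ (omf2Word g₁ (mulDrift e_δ) g₂)ⁿ` with the consistent
kicks — the quantity in the Metropolis test of the OMF2 kernel (exact by `GaugeFTHMCSymmetricWord`):
`|H(Ψ_n(q,p)) − H(q,p)| ≤ n·K|δ|·(‖p‖ + (n+1)γ₂)·((8|1−2λ| + 16|λ| + 8)·(Σ_l‖p_l‖ + (n+1)|ι|γ₂) + 32λ²|ι|D_max/κ)`,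
`γ₂ = (2|λ| + |1−2λ|)·D_max/κ` — `O(nδ²) = O(τδ)` at fixed trajectory length once `K, D_max = O(δ)`. -/
theorem abs_su2Omf2ProposalN_energy_error_le (S : (ι → Matrix.specialUnitaryGroup (Fin 2) ℂ) → ℝ) (δ κ lam : ℝ)
    (hκ : 0 < κ)
    (hd : ∀ W : ι → Matrix.specialUnitaryGroup (Fin 2) ℂ,
      DifferentiableAt ℝ (fun a : ι → EuclideanSpace ℝ (Fin 3) => S (su2ExpDrift δ a * W)) 0)
    {Dmax K : ℝ} (hD0 : 0 ≤ Dmax) (hK0 : 0 ≤ K)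
    (hDb : ∀ (W : ι → Matrix.specialUnitaryGroup (Fin 2) ℂ) (l : ι), ‖(fun (W : ι → Matrix.specialUnitaryGroup (Fin 2) ℂ) (l : ι) => WithLp.toLp 2 (fun i : Fin 3 => fderiv ℝ (fun a : ι → EuclideanSpace ℝ (Fin 3) => S (su2ExpDrift δ a * W)) 0 (Pi.single l (EuclideanSpace.single i (1 : ℝ))))) W l‖ ≤ Dmax)
    (hDK : ∀ W W' : ι → Matrix.specialUnitaryGroup (Fin 2) ℂ, ‖(fun (W : ι → Matrix.specialUnitaryGroup (Fin 2) ℂ) (l : ι) => WithLp.toLp 2 (fun i : Fin 3 => fderiv ℝ (fun a : ι → EuclideanSpace ℝ (Fin 3) => S (su2ExpDrift δ a * W)) 0 (Pi.single l (EuclideanSpace.single i (1 : ℝ))))) W - (fun (W : ι → Matrix.specialUnitaryGroup (Fin 2) ℂ) (l : ι) => WithLp.toLp 2 (fun i : Fin 3 => fderiv ℝ (fun a : ι → EuclideanSpace ℝ (Fin 3) => S (su2ExpDrift δ a * W)) 0 (Pi.single l (EuclideanSpace.single i (1 : ℝ))))) W'‖ ≤ K * ‖coeConfig W - coeConfig 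W'‖)
    (q : ι → Matrix.specialUnitaryGroup (Fin 2) ℂ) (p : ι → EuclideanSpace ℝ (Fin 3)) (n : ℕ) :
    |(S (((flip * (omf2Word (fun (W : ι → Matrix.specialUnitaryGroup (Fin 2) ℂ) (l : ι) => -(lam / κ) • (fun (W : ι → Matrix.specialUnitaryGroup (Fin 2) ℂ) (l : ι) => WithLp.toLp 2 (fun i : Fin 3 => fderiv ℝ (fun a : ι → EuclideanSpace ℝ (Fin 3) => S (su2ExpDrift δ a * W)) 0 (Pi.single l (EuclideanSpace.single i (1 : ℝ))))) W l) (mulDrift (su2ExpDrift δ)) (fun (W : ι → Matrix.specialUnitaryGroup (Fin 2) ℂ) (l : ι) => -((1 - 2 * lam) / κ) • (fun (W : ι → Matrix.specialUnitaryGroup (Fin 2) ℂ) (l : ι) => WithLp.toLp 2 (fun i : Fin 3 => fderiv ℝ (fun a : ι → EuclideanSpace ℝ (Fin 3) => S (su2ExpDrift δ a * W)) 0 (Pi.single l (EuclideanSpace.single i (1 : ℝ))))) W l)) ^ n :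
          Equiv.Perm ((ι → Matrix.specialUnitaryGroup (Fin 2) ℂ) × (ι → EuclideanSpace ℝ (Fin 3)))) (q, p))).1 +
        su2Kinetic κ (((flip * (omf2Word (fun (W : ι → Matrix.specialUnitaryGroup (Fin 2) ℂ) (l : ι) => -(lam / κ) • (fun (W : ι → Matrix.specialUnitaryGroup (Fin 2) ℂ) (l : ι) => WithLp.toLp 2 (fun i : Fin 3 => fderiv ℝ (fun a : ι → EuclideanSpace ℝ (Fin 3) => S (su2ExpDrift δ a * W)) 0 (Pi.single l (EuclideanSpace.single i (1 : ℝ))))) W l) (mulDrift (su2ExpDrift δ)) (fun (W : ι → Matrix.specialUnitaryGroup (Fin 2) ℂ) (l : ι) => -((1 - 2 * lam) / κ) • (fun (W : ι → Matrix.specialUnitaryGroup (Fin 2) ℂ) (l : ι) => WithLp.toLp 2 (fun i : Fin 3 => fderiv ℝ (fun a : ι → EuclideanSpace ℝ (Fin 3) => S (su2ExpDrift δ a * W)) 0 (Pi.single l (EuclideanSpace.single i (1 : ℝ))))) W l)) ^ n :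
          Equiv.Perm ((ι → Matrix.specialUnitaryGroup (Fin 2) ℂ) × (ι → EuclideanSpace ℝ (Fin 3)))) (q, p))).2) -
      (S q + su2Kinetic κ p)| ≤
      n * (K * |δ| * (‖p‖ + (n + 1) * ((2 * |lam| + |1 - 2 * lam|) * (Dmax / κ))) *
        ((8 * |1 - 2 * lam| + 16 * |lam| + 8) * (∑ l, ‖p l‖ + (n + 1) * (Fintype.card ι * ((2 * |lam| + |1 - 2 * lam|) * (Dmax / κ)))) +
          32 * lam ^ 2 * (Fintype.card ι * Dmax / κ))) := by
  have h := abs_su2Omf2N_energy_error_le S δ κ lam hκ hd hD0 hK0 hDb hDK q p n n le_rfl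
  rw [Equiv.Perm.coe_mul, Function.comp_apply, flip_apply, Equiv.Perm.coe_pow]
  simp only [su2Kinetic_neg]
  exact h

end Summit.Ventures.LatticeQCDFlow.Exactness
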